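import Summits.BirchSwinnertonDyer.BirchSwinnertonDyer.Theorems.PrintCFramAcDescentThreeSplitDefs
import Literature.NumberTheory.EllipticCurves.LambdaAdicSelmerDataProofs
import HarnessLib

/-!
# The relaxed `Λ`-adic compact Selmer datum `𝒮^ac_rel = lim←_n Sel_rel(K^ac_n, T)` EXISTS for a
# topological generator — the inhabitation caveat of the `p = 3` split (`LambdaAdicRelaxedSelmerData`,
# file `PrintCFramAcDescentThreeSplitDefs`) REMOVED (cell `bsd-print-cfram`, D-0131 (2) PRINT tier,
# prover seat p1; line «acdescent3» on item stmt-BirchSwinnertonDyer-21353, helper)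

The split Defs file left honest limit (i): «if no `LambdaAdicRelaxedSelmerData (W.baseChange K) κ γ 𝔭`
term exists, piece (A)'s last clause is vacuous and piece (B) carries the whole content». This file
CONSTRUCTS such a term for every elliptic curve `V` over a number field `K`, every `ℤ_p`-extension `κ`
with topological generator `γ`, and every prime `𝔭` — VERBATIM the tree's construction of
Perrin-Riou's `𝔖_p(K_∞)` (`WeierstrassCurve.LambdaAdicSelmerDataExists.nonempty_lambdaAdicSelmerData`,
file `LambdaAdicSelmerDataProofs.lean`: carrier = norm-compatible families, `Λ`-action = the truncated
evaluation `Σ_{i<kpⁿ} coeff_i(f)(conj_γ − 1)^i`, legitimate because `(conj_γ − 1)^{kpⁿ} = 0` on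
`H¹(K^ac_n, E[p^k])`) with the compact Selmer condition replaced by the compact Selmer condition
RELAXED at `𝔭` (`relaxedCompactSelmerOver … {𝔭}`), whose only new input is that the relaxed Selmer
conditions are `conj`-stable too (`conjH1_mem_relaxedSelmerTorsionOver`, the same one-line argument
as the tree's `conjH1_mem_selmerTorsionOver`: the local conditions are imposed at all
`Γ_K`-conjugates). So in pieces (A)/(B) of the split the quantifier `∀ 𝒮` is NEVER vacuous
(`nonempty_lambdaAdicRelaxedSelmerData`), and the anticyclotomic class `z^ac` of every elliptic-unit
datum has a home (`exists_datum_and_zac`). A CONSTRUCTION with no arithmetic content; nothing about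
BSD is advanced by it; «beyond-print theorem»: NO.

References: [PerrinRiou1987BSMF] §0 pp. 401–402; [BurungaleKobayashiNakamuraOta2026] §3.2.2
(arXiv:2608.06879v1 p. 18: `𝒮^ac_rel`); [Lang1990] Ch. 5 §1 Thm. 1.1; tree
`LambdaAdicSelmerData{Level,}Proofs.lean` (seat bsd-littype-05).
-/

-- the summit namespace `Summit.BirchSwinnertonDyer.BirchSwinnertonDyer` repeats the problem name by design (D-0017)
set_option linter.dupNamespace false

noncomputable section

open scoped Classical

open WeierstrassCurve NumberField IsDedekindDomain Field PowerSeries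
  Literature.NumberTheory.GaloisRepresentations
  Literature.NumberTheory.EllipticCurves
  Literature.NumberTheory.EllipticCurves.IwasawaDual
  Literature.NumberTheory.EllipticCurves.BurungaleKobayashiNakamuraOta2026
  WeierstrassCurve.LambdaAdicSelmerDataExists

namespace Summit.BirchSwinnertonDyer.BirchSwinnertonDyer.Theorems.PrintCFram.AcDescentThreeSplit

/-! ## §1 The relaxed Selmer conditions are `conj`-stable -/

section Stable

variable {K : Type} [Field K] [NumberField K] (V : WeierstrassCurve K) (p : ℕ) [Fact p.Prime]
  (H : Subgroup (absoluteGaloisGroup K)) [H.Normal]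

omit [Fact p.Prime] in
/-- **Relaxed Selmer conditions are `conj`-stable**: `conj_σ Sel^{(m)}_{rel,P}(E/L) ⊆ Sel^{(m)}_{rel,P}(E/L)`
(the local conditions off `P` and at infinity are imposed at all `Γ_K`-conjugates;
`conj_τ conj_σ = conj_{τσ}`). [cite: PerrinRiou1987BSMF, §0 p. 401] [cite: GreenbergLNM1716, §1] -/
theorem conjH1_mem_relaxedSelmerTorsionOver (m : ℤ) (P : Set (HeightOneSpectrum (𝓞 K)))
    (σ : absoluteGaloisGroup K) {c : V.torsionH1Over m H}
    (hc : c ∈ V.relaxedSelmerTorsionOver H m P) :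
    Literature.NumberTheory.EllipticCurves.conjH1 H (geomTorsion V m) σ c ∈
      V.relaxedSelmerTorsionOver H m P := by
  rw [mem_relaxedSelmerTorsionOver_iff] at hc ⊢
  have hmul : ∀ τ, Literature.NumberTheory.EllipticCurves.conjH1 H (geomTorsion V m) τ
      (Literature.NumberTheory.EllipticCurves.conjH1 H (geomTorsion V m) σ c) =
      Literature.NumberTheory.EllipticCurves.conjH1 H (geomTorsion V m) (τ * σ) c := fun τ ↦ by
    rw [Literature.NumberTheory.EllipticCurves.conjH1_mul_holds H (geomTorsion V m) τ σ]; rfl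
  exact ⟨fun v hv τ ↦ by rw [hmul]; exact hc.1 v hv (τ * σ), fun w τ ↦ by rw [hmul]; exact hc.2 w (τ * σ)⟩

variable {V H}

omit [Fact p.Prime] in
/-- Every power of `ψ = conj_γ − 1` preserves the relaxed Selmer group. [cite: GreenbergLNM1716, §1] -/
theorem psi_pow_mem_relaxedSelmerTorsionOver (P : Set (HeightOneSpectrum (𝓞 K)))
    {γ : absoluteGaloisGroup K} {k : ℕ} {ψ : AddMonoid.End (V.torsionH1Over ((p : ℤ) ^ k) H)}
    (hψ : ∀ y, ψ y = Literature.NumberTheory.EllipticCurves.conjH1 H (geomTorsion V ((p : ℤ) ^ k)) γ y - y)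
    (i : ℕ) {c : V.torsionH1Over ((p : ℤ) ^ k) H} (hc : c ∈ V.relaxedSelmerTorsionOver H ((p : ℤ) ^ k) P) :
    (ψ ^ i) c ∈ V.relaxedSelmerTorsionOver H ((p : ℤ) ^ k) P := by
  induction i generalizing c with
  | zero => exact hc
  | succ i ih =>
    rw [pow_succ, AddMonoid.End.coe_mul, Function.comp_apply, hψ]
    exact ih (sub_mem (conjH1_mem_relaxedSelmerTorsionOver V H _ P γ hc) hc)

/-- The truncated action preserves the relaxed Selmer group. [cite: PerrinRiou1987BSMF, §0 p. 401] -/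
theorem evalT_mem_relaxedSelmerTorsionOver (P : Set (HeightOneSpectrum (𝓞 K)))
    {γ : absoluteGaloisGroup K} {k : ℕ} {ψ : AddMonoid.End (V.torsionH1Over ((p : ℤ) ^ k) H)}
    (hψ : ∀ y, ψ y = Literature.NumberTheory.EllipticCurves.conjH1 H (geomTorsion V ((p : ℤ) ^ k)) γ y - y)
    (N : ℕ) (f : PowerSeries ℤ_[p]) {c : V.torsionH1Over ((p : ℤ) ^ k) H}
    (hc : c ∈ V.relaxedSelmerTorsionOver H ((p : ℤ) ^ k) P) :
    evalT p ψ N k f (AddMonoidHom.id _) c ∈ V.relaxedSelmerTorsionOver H ((p : ℤ) ^ k) P := by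
  rw [evalT_def]
  refine AddSubgroup.sum_mem _ fun i _ ↦ ?_
  rw [zpT_def, AddMonoidHom.id_apply]
  exact AddSubgroup.nsmul_mem _ (psi_pow_mem_relaxedSelmerTorsionOver p P hψ i hc) _

end Stable

/-! ## §2 Existence of the relaxed `Λ`-adic datum for a topological generator -/

section Exists

variable {K : Type} [Field K] [NumberField K] (V : WeierstrassCurve K) (p : ℕ) [Fact p.Prime]
  (κ : ZpExtension K p) {γ : absoluteGaloisGroup K} (𝔭 : HeightOneSpectrum (𝓞 K))

/-- **`𝒮^ac_rel` EXISTS as a `LambdaAdicRelaxedSelmerData`** for a topological generator `γ`: the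
model of the tree's `nonempty_lambdaAdicSelmerData` VERBATIM (carrier = norm-compatible families of
RELAXED compact Selmer elements; `Λ` acts componentwise by the truncated evaluation `evalT`; module
axioms from the `evalT` algebra; projections = coordinates), the relaxed Selmer condition being
preserved by `evalT_mem_relaxedSelmerTorsionOver`. [cite: PerrinRiou1987BSMF, §0 p. 402]
[cite: BurungaleKobayashiNakamuraOta2026, §3.2.2 (arXiv:2608.06879v1 p. 18) (the object; shape only)]
[cite: Lang1990, Ch. 5 §1 Thm. 1.1] -/
theorem nonempty_lambdaAdicRelaxedSelmerData (hγ : κ.IsTopGenerator γ) :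
    Nonempty (LambdaAdicRelaxedSelmerData V κ γ 𝔭) := by
  -- (0) `ψ_{n,k} = conj_γ − 1` on `H¹(K_n, E[p^k])`, kept opaque with its characterization
  have hψex : ∀ n k : ℕ, ∃ ψ : AddMonoid.End (V.torsionH1Over ((p : ℤ) ^ k) (κ.layerSubgroup n)),
      ∀ y, ψ y = Literature.NumberTheory.EllipticCurves.conjH1 (κ.layerSubgroup n)
        (geomTorsion V ((p : ℤ) ^ k)) γ y - y :=
    fun n k ↦ ⟨Literature.NumberTheory.EllipticCurves.conjH1 (κ.layerSubgroup n)
      (geomTorsion V ((p : ℤ) ^ k)) γ - AddMonoidHom.id _, fun _ ↦ rfl⟩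
  choose ψ hψ using hψex
  have htor : ∀ (n k : ℕ) (y : V.torsionH1Over ((p : ℤ) ^ k) (κ.layerSubgroup n)), p ^ k • y = 0 :=
    fun n k y ↦ pow_nsmul_eq_zero V p _ k y
  have hnil : ∀ (n k : ℕ) (y : V.torsionH1Over ((p : ℤ) ^ k) (κ.layerSubgroup n)),
      (ψ n k ^ (k * p ^ n)) y = 0 :=
    fun n k y ↦ psi_pow_apply_eq_zero (hψ n k) (pow_mem_layerSubgroup p κ hγ n) y
  -- (1) the carrier `lim←_n Sel_rel(K^ac_n, T)`, kept opaque with its membership characterization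
  obtain ⟨Sf, hSf⟩ : ∃ Sf : AddSubgroup (Π n k : ℕ, V.torsionH1Over ((p : ℤ) ^ k) (κ.layerSubgroup n)),
      ∀ x, x ∈ Sf ↔ (∀ n, x n ∈ V.relaxedCompactSelmerOver (κ.layerSubgroup n) p {𝔭}) ∧
        ∀ n, V.resPi p (κ.layerSubgroup_antitone (Nat.le_succ n)) (x n) =
          ∑ i ∈ Finset.range p, V.conjPi p (κ.layerSubgroup (n + 1)) (γ ^ (p ^ n * i)) (x (n + 1)) :=
    ⟨{ carrier := {x | (∀ n, x n ∈ V.relaxedCompactSelmerOver (κ.layerSubgroup n) p {𝔭}) ∧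
          ∀ n, V.resPi p (κ.layerSubgroup_antitone (Nat.le_succ n)) (x n) =
            ∑ i ∈ Finset.range p, V.conjPi p (κ.layerSubgroup (n + 1)) (γ ^ (p ^ n * i)) (x (n + 1))}
       zero_mem' := ⟨fun n ↦ zero_mem _, fun n ↦ by simp⟩
       add_mem' := fun {x y} hx hy ↦ ⟨fun n ↦ add_mem (hx.1 n) (hy.1 n), fun n ↦ by
          rw [Pi.add_apply, map_add, hx.2 n, hy.2 n, ← Finset.sum_add_distrib]
          exact Finset.sum_congr rfl fun i _ ↦ (map_add _ _ _).symm⟩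
       neg_mem' := fun {x} hx ↦ ⟨fun n ↦ neg_mem (hx.1 n), fun n ↦ by
          rw [Pi.neg_apply, map_neg, hx.2 n, ← Finset.sum_neg_distrib]
          exact Finset.sum_congr rfl fun i _ ↦ (map_neg _ _).symm⟩ }, fun _ ↦ Iff.rfl⟩
  -- (2) the truncated action preserves the carrier
  have hmem : ∀ (f : IwasawaAlgebra p) (x : Π n k : ℕ, V.torsionH1Over ((p : ℤ) ^ k) (κ.layerSubgroup n)),
      x ∈ Sf → (fun n k ↦ evalT p (ψ n k) (k * p ^ n) k f (AddMonoidHom.id _) (x n k)) ∈ Sf := by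
    intro f x hx
    rw [hSf] at hx ⊢
    refine ⟨fun n ↦ ?_, fun n ↦ ?_⟩
    · -- relaxed compact Selmer: relaxed Selmer at each level (`conj`-stability), `p_*`-compatible
      have hxn := (mem_relaxedCompactSelmerOver_iff (W := V) (H := κ.layerSubgroup n)).1 (hx.1 n)
      have hxc := (mem_compatiblePi_iff (W := V) (H := κ.layerSubgroup n)).1 hxn.2
      rw [mem_relaxedCompactSelmerOver_iff, mem_compatiblePi_iff]
      refine ⟨fun k ↦ evalT_mem_relaxedSelmerTorsionOver p {𝔭} (hψ n k) _ f (hxn.1 k), fun k ↦ ?_⟩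
      rw [map_evalT_id _ _ (V.reduceTorsionH1 p k (κ.layerSubgroup n))
        (reduceTorsionH1_psi p (hψ n (k + 1)) (hψ n k)) ((k + 1) * p ^ n) (k + 1) f (x n (k + 1)),
        hxc k]
      exact evalT_of_le (Nat.mul_le_mul_right _ (Nat.le_succ k)) (Nat.le_succ k) f _
        (hnil n k (x n k)) (htor n k (x n k))
    · -- norm compatibility (transport along `res` and `conj_{γ^j}`; truncation change by `evalT_of_le`)
      funext k
      have hres : V.resPi p (κ.layerSubgroup_antitone (Nat.le_succ n))
          (fun k ↦ evalT p (ψ n k) (k * p ^ n) k f (AddMonoidHom.id _) (x n k)) k =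
          evalT p (ψ (n + 1) k) (k * p ^ n) k f (AddMonoidHom.id _)
            (V.resPi p (κ.layerSubgroup_antitone (Nat.le_succ n)) (x n) k) := by
        simp only [WeierstrassCurve.resPi, AddMonoidHom.pi_apply, AddMonoidHom.coe_comp,
          Function.comp_apply, Pi.evalAddMonoidHom_apply]
        exact map_evalT_id _ _ _
          (resOfLe_psi p (κ.layerSubgroup_antitone (Nat.le_succ n)) (hψ n k) (hψ (n + 1) k)) _ _ f _
      have hconj : ∀ i, V.conjPi p (κ.layerSubgroup (n + 1)) (γ ^ (p ^ n * i))
          (fun k ↦ evalT p (ψ (n + 1) k) (k * p ^ (n + 1)) k f (AddMonoidHom.id _) (x (n + 1) k)) k =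
          evalT p (ψ (n + 1) k) (k * p ^ (n + 1)) k f (AddMonoidHom.id _)
            (V.conjPi p (κ.layerSubgroup (n + 1)) (γ ^ (p ^ n * i)) (x (n + 1)) k) := fun i ↦ by
        simp only [WeierstrassCurve.conjPi, AddMonoidHom.pi_apply, AddMonoidHom.coe_comp,
          Function.comp_apply, Pi.evalAddMonoidHom_apply]
        exact map_evalT_id _ _ _
          (conjH1_psi_of_commute p (Commute.pow_left (Commute.refl γ) _) (hψ (n + 1) k)) _ _ f _
      -- the restricted class comes from level `n`: it is killed by `ψ^{k pⁿ}` already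
      have hresN : (ψ (n + 1) k ^ (k * p ^ n))
          (V.resPi p (κ.layerSubgroup_antitone (Nat.le_succ n)) (x n) k) = 0 := by
        have h := map_pow_apply (ψ n k) (ψ (n + 1) k)
          (Literature.NumberTheory.EllipticCurves.resOfLe (geomTorsion V ((p : ℤ) ^ k))
            (κ.layerSubgroup_antitone (Nat.le_succ n)))
          (resOfLe_psi p (κ.layerSubgroup_antitone (Nat.le_succ n)) (hψ n k) (hψ (n + 1) k))
          (k * p ^ n) (x n k)
        simp only [WeierstrassCurve.resPi, AddMonoidHom.pi_apply, AddMonoidHom.coe_comp,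
          Function.comp_apply, Pi.evalAddMonoidHom_apply]
        rw [← h, hnil n k (x n k), map_zero]
      rw [hres, Finset.sum_apply, Finset.sum_congr rfl fun i _ ↦ hconj i,
        ← evalT_of_le (Nat.mul_le_mul_left k (Nat.pow_le_pow_right (Fact.out : p.Prime).pos
          (Nat.le_succ n))) le_rfl f _ hresN (htor (n + 1) k _), congrFun (hx.2 n) k, Finset.sum_apply]
      exact evalT_id_sum _ _ _ f _ _
  -- (3) the `Λ`-module structure (local instances; axioms from the `evalT` algebra)
  letI instSMul : SMul (IwasawaAlgebra p) Sf := ⟨fun f x ↦ ⟨_, hmem f x.1 x.2⟩⟩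
  have hsmul : ∀ (f : IwasawaAlgebra p) (x : Sf) (n k : ℕ), (f • x).1 n k =
      evalT p (ψ n k) (k * p ^ n) k f (AddMonoidHom.id _) (x.1 n k) := fun _ _ _ _ ↦ rfl
  letI instModule : Module (IwasawaAlgebra p) Sf := Module.ofMinimalAxioms
    (fun f x y ↦ Subtype.ext <| funext fun n ↦ funext fun k ↦ by
      rw [hsmul]
      change _ = (f • x).1 n k + (f • y).1 n k
      rw [hsmul, hsmul]
      exact evalT_add_right _ _ f _ _ _)
    (fun f g x ↦ Subtype.ext <| funext fun n ↦ funext fun k ↦ by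
      rw [hsmul]
      change _ = (f • x).1 n k + (g • x).1 n k
      rw [hsmul, hsmul]
      exact evalT_add_left f g _ (htor n k _))
    (fun f g x ↦ Subtype.ext <| funext fun n ↦ funext fun k ↦ by
      rw [hsmul, hsmul, hsmul]
      exact evalT_id_mul _ f g (hnil n k _) (htor n k _))
    (fun x ↦ Subtype.ext <| funext fun n ↦ funext fun k ↦ by
      rw [hsmul]
      exact evalT_one _ (hnil n k _) (htor n k _))
  -- (4) the datum: projections = coordinates
  refine ⟨
    { S := Sf
      proj := fun n ↦ (Pi.evalAddMonoidHom _ n).comp Sf.subtype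
      proj_mem := fun n s ↦ ((hSf s.1).1 s.2).1 n
      proj_X := fun n s ↦ ?_
      proj_C := fun n s c ↦ ?_
      proj_cont := fun n k s f hf ↦ ?_
      proj_norm := fun n s ↦ ((hSf s.1).1 s.2).2 n
      ext := fun s hs ↦ Subtype.ext (funext fun n ↦ hs n)
      surj := fun x hsel hnorm ↦ ⟨⟨x, (hSf x).2 ⟨hsel, hnorm⟩⟩, fun _ ↦ rfl⟩ }⟩
  · -- `T ↦ conj_γ − 1` (`evalT_X`)
    funext k
    change ((PowerSeries.X : IwasawaAlgebra p) • s).1 n k = _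
    rw [hsmul, evalT_X _ (hnil n k _) (htor n k _), AddMonoidHom.id_apply, hψ]
    rfl
  · -- constants through `ℤ_p → ℤ/p^k` (`evalT_C`)
    funext k
    change ((PowerSeries.C c : IwasawaAlgebra p) • s).1 n k = _
    rw [hsmul, evalT_C c _ (hnil n k _) (htor n k _), AddMonoidHom.id_apply, zpT_def]
    simp only [WeierstrassCurve.padicPi, AddMonoidHom.pi_apply, AddMonoidHom.coe_comp,
      Function.comp_apply, Pi.evalAddMonoidHom_apply, zsmulAddGroupHom_apply, natCast_zsmul]
    rfl
  · -- continuity = the truncation at `k pⁿ`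
    change (f • s).1 n k = 0
    rw [hsmul, evalT_def]
    exact Finset.sum_eq_zero fun i hi ↦ by rw [hf i (Finset.mem_range.mp hi), zpT_zero_left]

/-- **In pieces (A)/(B) of the split the quantifier over relaxed data is NEVER vacuous**: under the
binder `[Fact (κ.IsTopGenerator γ)]` of the Zp₃ carrier a relaxed `Λ`-adic datum exists.
[cite: PerrinRiou1987BSMF, §0 p. 402] -/
theorem nonempty_lambdaAdicRelaxedSelmerData_of_fact [hγ : Fact (κ.IsTopGenerator γ)] :
    Nonempty (LambdaAdicRelaxedSelmerData V κ γ 𝔭) :=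
  nonempty_lambdaAdicRelaxedSelmerData V p κ 𝔭 hγ.out

/-- **Every elliptic-unit datum's anticyclotomic class has a home**: for a topological generator `γ`
there are a relaxed `Λ`-adic datum `𝒮` and `zac ∈ 𝒮.S` with `proj n zac = D.z n` for all `n`
(existence of `𝒮` by the construction above; `zac` by `existsUnique_proj_eq`).
[cite: BurungaleKobayashiNakamuraOta2026, (3.9) "z^ac ∈ 𝒮^ac_rel" (arXiv:2608.06879v1 p. 19) (claim; preprint)] -/
theorem exists_datum_and_zac {W : WeierstrassCurve ℚ} [W.IsElliptic]
    {ι : PadicAlgCl p ≃+* ℂ} {φ : HeckeCharacter K} {Ω : ℂ} {𝓔 : AcDualExpSystem W p K 𝔭 κ ι}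
    (hγ : κ.IsTopGenerator γ) (D : EllipticUnitClassData W p K 𝔭 κ γ ι φ Ω 𝓔) :
    ∃ (𝒮 : LambdaAdicRelaxedSelmerData (W.baseChange K) κ γ 𝔭) (zac : 𝒮.S),
      ∀ n, 𝒮.proj n zac = D.z n := by
  obtain ⟨𝒮⟩ := nonempty_lambdaAdicRelaxedSelmerData (W.baseChange K) p κ 𝔭 hγ
  obtain ⟨zac, hzac, -⟩ := 𝒮.existsUnique_proj_eq D
  exact ⟨𝒮, zac, hzac⟩

end Exists

end Summit.BirchSwinnertonDyer.BirchSwinnertonDyer.Theorems.PrintCFram.AcDescentThreeSplit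

end
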